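import Summits.ABC.IUTFork.Repair.RHSzpiroBadCutReyssat
import HarnessLib

/-!
# D-0079 RESCUE sub-cell R-H, ROUND 1 row 2 «szpiro-bad-datum-cut»: the KILL on the SZPIRO-BAD FREY FAMILY in kernel —
# a generic `ord_p j(a/c) = −2·v_p(abc)` for abc triples and named instances at the window («ceiling») data of R-W's WINDOW-TABLE v3

PROOF-ONLY file (0 definitions, 0 `Prop` facts; abc-iut cell, rung LADDER-ABC:A2.RESCUE.H; seat abc-iut-rh-typ-2 = typer of pair n = 2).
TAKES NO SIDE on [IUTchIII] Cor. 3.12 or on any author; `RHSzpiroBadCut.I06StarCellsAt` is a HYPOTHESIS shape; statements about OUR typed objects;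
typed ≠ proved; refuted-as-typed ≠ refuted-in-print. NOTHING here constructs a Θ-volume datum (initial Θ-data at a Frey–Legendre point are NOT
claimed to exist); every theorem reads «for every such datum, IF it exists».

§1 `jInv_frey_eq` — for naturals `a + b = c` (`a, b > 0`): `j(a/c) = 2⁸·(b² + ac)³/(abc)²` (Legendre `j = 2⁸(λ²−λ+1)³/(λ²(λ−1)²)` at `λ = a/c`);
   `ord_jInv_frey` — at the place of `ℚ` over a prime `p` with `abc = p^m·r`, `p ∤ r`, `p ∤ 2⁸(b²+ac)³`: `ord_p j(a/c) = −2m`.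
§2 `criterion_of_pow_lt` — the real inequality of `RHSzpiroBadCutReyssat.not_i06StarCellsAt_ratPoint_of_ord_le` from two INTEGER checks
   `184320·l⁴ < p^k` and `2l·(2 + k) ≤ ((i+1)² − 1)·h`.
§3 `not_i06StarCellsAt_frey` — the generic Frey-row theorem: all side conditions are `norm_num`/`decide` integer facts.
§4 INSTANCES (each: `∀ T : Cor22.ThetaVolumeDatumAt (ratPoint (a/c)) l, ¬ I06StarCellsAt T`, model-free): the WINDOW («ceiling») data of R-W's
   WINDOW-TABLE v3 F-block — the Szpiro-bad data where R-W's engines do NOT refute S_H (START-HERE §3 (L2)), so that «I06⋆ fails even where the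
   licence may hold» is a theorem there (`283 + 5¹¹·13² = 2⁸3⁸17³` at `l ∈ {13,17,19,283}`, `1 + 3¹⁶·7 = 2³·11·23·53³` at `l = 23`, `7³ + 3¹⁰ = 2¹¹·29`
   at `l = 29`, `73 + 2¹³7⁷941² = 3¹⁶103³127` at `l ∈ {73,127}`) — plus the Reyssat triple `2 + 3¹⁰·109 = 23⁵` at `l ∈ {13,17,19,109}`. Sequel files
   `RHSzpiroBadCutFreyFamily2…4` carry the remaining Szpiro-bad data of the block (ids `F01…F37` = its 37 triples sorted by `c`).
[cite: Mochizuki2012, IUTchI Def. 3.1 p. 61, Ex. 3.2 (iv) p. 71; IUTchIV Prop. 1.2 (i) p. 10, Thm. 1.10 proof Step (ii) p. 24, Cor. 2.2 (ii) proof (P5) p. 46]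
[cite: MochizukiAbsTopIII2015, Def 5.4 (iii) p. 126] [cite: DupuyHilado2025, §3.3, §3.4] [claim: Mochizuki2012, status: disputed] for every IUT locution.
Axioms: standard. No instance, no notation.
-/

noncomputable section

open Set Metric Function NumberField IsDedekindDomain
open scoped Pointwise

namespace Summit.ABC.IUTFork.Repair.RHSzpiroBadCutFreyFamily

open Thm311 Thm311.Real Cor312 Cor312Vol Cor312Prov Literature.IUT.LogThetaLattice Literature.IUT.LogVolume
  Literature.IUT.HodgeTheaters Literature.IUT.LogVolume.ThetaData Literature.AnabelianGeometry.AbsoluteAnabelian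
  Literature.NumberTheory.NumberFields Literature.NumberTheory.DiophantineGeometry
open Literature.NumberTheory.DiophantineGeometry.GenEll
open Summit.ABC.IUTFork.Repair.RHSzpiroBadCut Summit.ABC.IUTFork.Repair.RHSzpiroBadCutReyssat

/-! ## §1. `j(a/c)` for an abc triple and its order at an odd prime of `abc` -/

/-- **`j(a/c) = 2⁸·(b² + ac)³/(abc)²`** for naturals `a + b = c`, `a, b > 0` (Legendre `j`-invariant `2⁸(λ²−λ+1)³/(λ²(λ−1)²)` at `λ = a/c`:
`λ − 1 = −b/c`, `λ² − λ + 1 = (b² + ac)/c²`). [folklore] -/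
theorem jInv_frey_eq {a b c : ℕ} (habc : a + b = c) (ha : 0 < a) (hb : 0 < b) :
    Cor22.jInv ((a : ℚ) / c) = ((256 * (b ^ 2 + a * c) ^ 3 : ℕ) : ℚ) / (((a * b * c) ^ 2 : ℕ) : ℚ) := by
  have hc : 0 < c := by omega
  have ha' : (a : ℚ) ≠ 0 := by exact_mod_cast ha.ne'
  have hb' : (b : ℚ) ≠ 0 := by exact_mod_cast hb.ne'
  have hc' : (c : ℚ) ≠ 0 := by exact_mod_cast hc.ne'
  have hbq : (b : ℚ) = c - a := by
    have h := congrArg (Nat.cast : ℕ → ℚ) habc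
    push_cast at h
    linarith
  have h1 : (a : ℚ) / c - 1 = -(b : ℚ) / c := by rw [hbq]; field_simp; ring
  have h2 : ((a : ℚ) / c) ^ 2 - (a : ℚ) / c + 1 = ((b : ℚ) ^ 2 + a * c) / c ^ 2 := by rw [hbq]; field_simp; ring
  unfold Cor22.jInv
  rw [h2, mul_pow, h1]
  push_cast
  field_simp
  ring

/-- A natural number prime to the prime under `v` has `ord_v = 0`. [folklore] -/
private theorem ord_natCast_eq_zero_of_not_dvd₃ (v : HeightOneSpectrum (𝓞 ℚ)) {n : ℕ}
    (h : ¬ Rat.HeightOneSpectrum.natGenerator v ∣ n) : ord ℚ v (n : ℚ) = 0 := by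
  unfold ord
  rw [(UniformABCConjecture.valuation_natCast_eq_one_iff v n).2 h, WithZero.log_one, neg_zero]

/-- **`ord_p j(a/c) = −2m`** at the place `v` of `ℚ` over `p`, for an abc triple `a + b = c` with `abc = p^m·r`, `p ∤ r` and `p ∤ 2⁸(b² + ac)³`
(automatic for odd `p ∣ abc` with `gcd(a, b) = 1`; supplied as a decidable check). [folklore] -/
theorem ord_jInv_frey (v : HeightOneSpectrum (𝓞 ℚ)) {p a b c m r : ℕ} (hv : Rat.HeightOneSpectrum.natGenerator v = p)
    (habc : a + b = c) (ha : 0 < a) (hb : 0 < b) (hfac : a * b * c = p ^ m * r) (hr : ¬ p ∣ r)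
    (hN : ¬ p ∣ 256 * (b ^ 2 + a * c) ^ 3) :
    ord ℚ v (Cor22.jInv ((a : ℚ) / c)) = -(2 * m : ℤ) := by
  have hc : 0 < c := by omega
  have hr0 : r ≠ 0 := by
    intro h0; rw [h0, mul_zero] at hfac
    exact (Nat.mul_ne_zero (Nat.mul_ne_zero ha.ne' hb.ne') hc.ne') hfac
  have hA : ¬ Rat.HeightOneSpectrum.natGenerator v ∣ 256 * (b ^ 2 + a * c) ^ 3 := by rwa [hv]
  have hB : ¬ Rat.HeightOneSpectrum.natGenerator v ∣ r := by rwa [hv]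
  have hA0 : ((256 * (b ^ 2 + a * c) ^ 3 : ℕ) : ℚ) ≠ 0 := by positivity
  have hr0' : (r : ℚ) ≠ 0 := by exact_mod_cast hr0
  have hp0 : (p : ℚ) ^ m ≠ 0 := by
    apply pow_ne_zero
    have : p ≠ 0 := by rw [← hv]; exact (Rat.HeightOneSpectrum.prime_natGenerator v).ne_zero
    exact_mod_cast this
  have hpord : ord ℚ v (p : ℚ) = 1 := by
    have := Cor22.ord_natGenerator_eq_one v
    rwa [hv] at this
  have hden : (((a * b * c) ^ 2 : ℕ) : ℚ) = ((p : ℚ) ^ m * r) ^ 2 := by rw [hfac]; push_cast; ring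
  rw [jInv_frey_eq habc ha hb, hden, div_eq_mul_inv, ord_mul ℚ v hA0 (inv_ne_zero (pow_ne_zero _ (mul_ne_zero hp0 hr0'))), ord_inv,
    ord_pow, ord_mul ℚ v hp0 hr0', ord_pow, ord_natCast_eq_zero_of_not_dvd₃ v hA, ord_natCast_eq_zero_of_not_dvd₃ v hB, hpord]
  push_cast
  ring

/-! ## §2. The real criterion from two integer checks -/

/-- **Integer form of the criterion**: `184320·l⁴ < p^k` and `2l·(2 + k) ≤ ((i+1)² − 1)·h` (naturals, `1 ≤ (i+1)²`) give
`2l·(2 + log_p(184320·l⁴)) < ((i+1)² − 1)·h` over `ℝ`. [folklore] -/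
theorem criterion_of_pow_lt {p l k i h : ℕ} (hp : 1 < p) (hl : 1 ≤ l) (hk : 184320 * l ^ 4 < p ^ k)
    (har : 2 * l * (2 + k) ≤ ((i + 1) ^ 2 - 1) * h) :
    2 * (l : ℝ) * (2 + Real.logb (p : ℕ) ((184320 * l ^ 4 : ℕ) : ℝ)) < ((((i : ℕ) : ℝ) + 1) ^ 2 - 1) * h := by
  have hpR : (1 : ℝ) < (p : ℝ) := by exact_mod_cast hp
  have hX : (0 : ℝ) < ((184320 * l ^ 4 : ℕ) : ℝ) := by
    have : 0 < 184320 * l ^ 4 := by positivity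
    exact_mod_cast this
  have hlog : Real.logb (p : ℕ) ((184320 * l ^ 4 : ℕ) : ℝ) < k := by
    rw [Real.logb_lt_iff_lt_rpow hpR hX, Real.rpow_natCast]
    exact_mod_cast hk
  have hsq : 1 ≤ (i + 1) ^ 2 := Nat.one_le_pow _ _ (by omega)
  have harR : 2 * (l : ℝ) * (2 + k) ≤ ((((i : ℕ) : ℝ) + 1) ^ 2 - 1) * h := by
    have h' := har
    have hcast : (((i + 1) ^ 2 - 1 : ℕ) : ℝ) = (((i : ℕ) : ℝ) + 1) ^ 2 - 1 := by
      rw [Nat.cast_sub hsq]; push_cast; ring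
    have hR : ((((i + 1) ^ 2 - 1) * h : ℕ) : ℝ) = ((((i : ℕ) : ℝ) + 1) ^ 2 - 1) * h := by rw [Nat.cast_mul, hcast]
    have : ((2 * l * (2 + k) : ℕ) : ℝ) ≤ ((((i + 1) ^ 2 - 1) * h : ℕ) : ℝ) := Nat.cast_le.mpr h'
    rw [hR] at this
    push_cast at this
    linarith
  have hl0 : (0 : ℝ) < 2 * (l : ℝ) := by
    have : (1 : ℝ) ≤ l := by exact_mod_cast hl
    linarith
  have : 2 * (l : ℝ) * (2 + Real.logb (p : ℕ) ((184320 * l ^ 4 : ℕ) : ℝ)) < 2 * (l : ℝ) * (2 + k) := by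
    apply mul_lt_mul_of_pos_left _ hl0
    linarith
  linarith

/-! ## §3. The generic Frey-row theorem -/

/-- **KERNEL I06⋆-NEG ON A FREY ROW (model-free).** For an abc triple `a + b = c` (`a, b > 0`), a prime `l`-level datum
`T : Cor22.ThetaVolumeDatumAt (ratPoint (a/c)) l`, an odd prime `p ≠ l` with `abc = p^m·r`, `p ∤ r`, `p ∤ 2⁸(b²+ac)³`, `m ≥ 1`, and integers `k`, `i`
with `184320·l⁴ < p^k`, `i < (l−1)/2`, `2l·(2 + k) ≤ ((i+1)² − 1)·2m`: `¬ RHSzpiroBadCut.I06StarCellsAt T`. All hypotheses are decidable integer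
facts; the work is `RHSzpiroBadCutReyssat.not_i06StarCellsAt_ratPoint_of_ord_le`. Existence of `T` is NOT claimed.
[cite: Mochizuki2012, IUTchIV Prop. 1.2 (i) p. 10, Thm. 1.10 proof Step (ii) p. 24, Cor. 2.2 (ii) proof (P5) p. 46] [claim: Mochizuki2012, status: disputed] -/
theorem not_i06StarCellsAt_frey {a b c l : ℕ} (T : Cor22.ThetaVolumeDatumAt (ratPoint ((a : ℚ) / c)) l)
    (habc : a + b = c) (ha : 0 < a) (hb : 0 < b) (pp : Nat.Primes) (hp2 : (pp : ℕ) ≠ 2) (hpl : (pp : ℕ) ≠ l)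
    {m r : ℕ} (hm : 1 ≤ m) (hfac : a * b * c = (pp : ℕ) ^ m * r) (hr : ¬ (pp : ℕ) ∣ r) (hN : ¬ (pp : ℕ) ∣ 256 * (b ^ 2 + a * c) ^ 3)
    {k i : ℕ} (hl : 1 ≤ l) (hk : 184320 * l ^ 4 < (pp : ℕ) ^ k) (hi : i < (l - 1) / 2)
    (har : 2 * l * (2 + k) ≤ ((i + 1) ^ 2 - 1) * (2 * m)) :
    ¬ I06StarCellsAt T :=
  not_i06StarCellsAt_ratPoint_of_ord_le T pp hp2 hpl (2 * m) (by omega)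
    (fun u hu => by rw [ord_jInv_frey u hu habc ha hb hfac hr hN]; push_cast; exact le_refl _) i hi
    (criterion_of_pow_lt pp.2.one_lt hl hk har)

/-! ## §4. Instances: the WINDOW («ceiling») data of R-W's Szpiro-bad F-block (every packet un-refuted by R-W's engines) and the Reyssat triple at
every Szpiro-bad `l` of the table — triple ids `F01…F37` = the 37 triples of the block sorted by `c` (full list: the sequel files) -/

/-- **F01: `343 + 59049 = 59392`, `l = 29`** (`p = 3`, `m = v_p(abc) = 10`, `k = 24`, top label `i = 13`); R-W datum
`pilotDataOfK:frey-343-59049-59392:29` (Szpiro-bad, margin -7.870766; every packet WINDOW (S_H not refuted by R-W)). Model-free kernel NEG of the I06⋆ data clause for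
EVERY Θ-volume datum there (existence not claimed). [claim: Mochizuki2012, status: disputed] -/
theorem not_i06StarCellsAt_F01_l29
    (T : Cor22.ThetaVolumeDatumAt (ratPoint ((343 : ℕ) / (59392 : ℕ) : ℚ)) 29) : ¬ I06StarCellsAt T :=
  not_i06StarCellsAt_frey T (b := 59049) (by norm_num) (by norm_num) (by norm_num) ⟨3, by norm_num⟩ (by norm_num) (by norm_num)
    (m := 10) (r := 20371456) (by norm_num) (by norm_num) (by norm_num) (by norm_num)
    (k := 24) (i := 13) (by norm_num) (by norm_num) (by norm_num) (by norm_num)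

/-- **F02: `2 + 6436341 = 6436343`, `l = 13`** (`p = 3`, `m = v_p(abc) = 10`, `k = 21`, top label `i = 5`); R-W datum
`pilotDataOfK:frey-2-6436341-6436343:13` (Szpiro-bad, margin -0.333067; R-W refutes S_H at some packet). Model-free kernel NEG of the I06⋆ data clause for
EVERY Θ-volume datum there (existence not claimed). [claim: Mochizuki2012, status: disputed] -/
theorem not_i06StarCellsAt_F02_l13
    (T : Cor22.ThetaVolumeDatumAt (ratPoint ((2 : ℕ) / (6436343 : ℕ) : ℚ)) 13) : ¬ I06StarCellsAt T :=
  not_i06StarCellsAt_frey T (b := 6436341) (by norm_num) (by norm_num) (by norm_num) ⟨3, by norm_num⟩ (by norm_num) (by norm_num)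
    (m := 10) (r := 1403122774) (by norm_num) (by norm_num) (by norm_num) (by norm_num)
    (k := 21) (i := 5) (by norm_num) (by norm_num) (by norm_num) (by norm_num)

/-- **F02: `2 + 6436341 = 6436343`, `l = 17`** (`p = 3`, `m = v_p(abc) = 10`, `k = 22`, top label `i = 7`); R-W datum
`pilotDataOfK:frey-2-6436341-6436343:17` (Szpiro-bad, margin -1.512744; R-W refutes S_H at some packet). Model-free kernel NEG of the I06⋆ data clause for
EVERY Θ-volume datum there (existence not claimed). [claim: Mochizuki2012, status: disputed] -/
theorem not_i06StarCellsAt_F02_l17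
    (T : Cor22.ThetaVolumeDatumAt (ratPoint ((2 : ℕ) / (6436343 : ℕ) : ℚ)) 17) : ¬ I06StarCellsAt T :=
  not_i06StarCellsAt_frey T (b := 6436341) (by norm_num) (by norm_num) (by norm_num) ⟨3, by norm_num⟩ (by norm_num) (by norm_num)
    (m := 10) (r := 1403122774) (by norm_num) (by norm_num) (by norm_num) (by norm_num)
    (k := 22) (i := 7) (by norm_num) (by norm_num) (by norm_num) (by norm_num)

/-- **F02: `2 + 6436341 = 6436343`, `l = 19`** (`p = 3`, `m = v_p(abc) = 10`, `k = 22`, top label `i = 8`); R-W datum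
`pilotDataOfK:frey-2-6436341-6436343:19` (Szpiro-bad, margin -1.810529; R-W refutes S_H at some packet). Model-free kernel NEG of the I06⋆ data clause for
EVERY Θ-volume datum there (existence not claimed). [claim: Mochizuki2012, status: disputed] -/
theorem not_i06StarCellsAt_F02_l19
    (T : Cor22.ThetaVolumeDatumAt (ratPoint ((2 : ℕ) / (6436343 : ℕ) : ℚ)) 19) : ¬ I06StarCellsAt T :=
  not_i06StarCellsAt_frey T (b := 6436341) (by norm_num) (by norm_num) (by norm_num) ⟨3, by norm_num⟩ (by norm_num) (by norm_num)
    (m := 10) (r := 1403122774) (by norm_num) (by norm_num) (by norm_num) (by norm_num)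
    (k := 22) (i := 8) (by norm_num) (by norm_num) (by norm_num) (by norm_num)

/-- **F02: `2 + 6436341 = 6436343`, `l = 109`** (`p = 3`, `m = v_p(abc) = 10`, `k = 29`, top label `i = 53`); R-W datum
`pilotDataOfK:frey-2-6436341-6436343:109` (Szpiro-bad, margin -21.005131; R-W refutes S_H at some packet). Model-free kernel NEG of the I06⋆ data clause for
EVERY Θ-volume datum there (existence not claimed). [claim: Mochizuki2012, status: disputed] -/
theorem not_i06StarCellsAt_F02_l109
    (T : Cor22.ThetaVolumeDatumAt (ratPoint ((2 : ℕ) / (6436343 : ℕ) : ℚ)) 109) : ¬ I06StarCellsAt T :=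
  not_i06StarCellsAt_frey T (b := 6436341) (by norm_num) (by norm_num) (by norm_num) ⟨3, by norm_num⟩ (by norm_num) (by norm_num)
    (m := 10) (r := 1403122774) (by norm_num) (by norm_num) (by norm_num) (by norm_num)
    (k := 29) (i := 53) (by norm_num) (by norm_num) (by norm_num) (by norm_num)

/-- **F03: `1 + 301327047 = 301327048`, `l = 23`** (`p = 3`, `m = v_p(abc) = 16`, `k = 23`, top label `i = 10`); R-W datum
`pilotDataOfK:frey-1-301327047-301327048:23` (Szpiro-bad, margin -4.252547; every packet WINDOW (S_H not refuted by R-W)). Model-free kernel NEG of the I06⋆ data clause for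
EVERY Θ-volume datum there (existence not claimed). [claim: Mochizuki2012, status: disputed] -/
theorem not_i06StarCellsAt_F03_l23
    (T : Cor22.ThetaVolumeDatumAt (ratPoint ((1 : ℕ) / (301327048 : ℕ) : ℚ)) 23) : ¬ I06StarCellsAt T :=
  not_i06StarCellsAt_frey T (b := 301327047) (by norm_num) (by norm_num) (by norm_num) ⟨3, by norm_num⟩ (by norm_num) (by norm_num)
    (m := 16) (r := 2109289336) (by norm_num) (by norm_num) (by norm_num) (by norm_num)
    (k := 23) (i := 10) (by norm_num) (by norm_num) (by norm_num) (by norm_num)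

/-- **F05: `283 + 8251953125 = 8251953408`, `l = 13`** (`p = 5`, `m = v_p(abc) = 11`, `k = 14`, top label `i = 5`); R-W datum
`pilotDataOfK:frey-283-8251953125-8251953408:13` (Szpiro-bad, margin -5.490870; every packet WINDOW (S_H not refuted by R-W)). Model-free kernel NEG of the I06⋆ data clause for
EVERY Θ-volume datum there (existence not claimed). [claim: Mochizuki2012, status: disputed] -/
theorem not_i06StarCellsAt_F05_l13
    (T : Cor22.ThetaVolumeDatumAt (ratPoint ((283 : ℕ) / (8251953408 : ℕ) : ℚ)) 13) : ¬ I06StarCellsAt T :=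
  not_i06StarCellsAt_frey T (b := 8251953125) (by norm_num) (by norm_num) (by norm_num) ⟨5, by norm_num⟩ (by norm_num) (by norm_num)
    (m := 11) (r := 394666175644416) (by norm_num) (by norm_num) (by norm_num) (by norm_num)
    (k := 14) (i := 5) (by norm_num) (by norm_num) (by norm_num) (by norm_num)

/-- **F05: `283 + 8251953125 = 8251953408`, `l = 17`** (`p = 5`, `m = v_p(abc) = 11`, `k = 15`, top label `i = 7`); R-W datum
`pilotDataOfK:frey-283-8251953125-8251953408:17` (Szpiro-bad, margin -1.625070; every packet WINDOW (S_H not refuted by R-W)). Model-free kernel NEG of the I06⋆ data clause for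
EVERY Θ-volume datum there (existence not claimed). [claim: Mochizuki2012, status: disputed] -/
theorem not_i06StarCellsAt_F05_l17
    (T : Cor22.ThetaVolumeDatumAt (ratPoint ((283 : ℕ) / (8251953408 : ℕ) : ℚ)) 17) : ¬ I06StarCellsAt T :=
  not_i06StarCellsAt_frey T (b := 8251953125) (by norm_num) (by norm_num) (by norm_num) ⟨5, by norm_num⟩ (by norm_num) (by norm_num)
    (m := 11) (r := 394666175644416) (by norm_num) (by norm_num) (by norm_num) (by norm_num)
    (k := 15) (i := 7) (by norm_num) (by norm_num) (by norm_num) (by norm_num)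

/-- **F05: `283 + 8251953125 = 8251953408`, `l = 19`** (`p = 5`, `m = v_p(abc) = 11`, `k = 15`, top label `i = 8`); R-W datum
`pilotDataOfK:frey-283-8251953125-8251953408:19` (Szpiro-bad, margin -2.308320; every packet WINDOW (S_H not refuted by R-W)). Model-free kernel NEG of the I06⋆ data clause for
EVERY Θ-volume datum there (existence not claimed). [claim: Mochizuki2012, status: disputed] -/
theorem not_i06StarCellsAt_F05_l19
    (T : Cor22.ThetaVolumeDatumAt (ratPoint ((283 : ℕ) / (8251953408 : ℕ) : ℚ)) 19) : ¬ I06StarCellsAt T :=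
  not_i06StarCellsAt_frey T (b := 8251953125) (by norm_num) (by norm_num) (by norm_num) ⟨5, by norm_num⟩ (by norm_num) (by norm_num)
    (m := 11) (r := 394666175644416) (by norm_num) (by norm_num) (by norm_num) (by norm_num)
    (k := 15) (i := 8) (by norm_num) (by norm_num) (by norm_num) (by norm_num)

/-- **F05: `283 + 8251953125 = 8251953408`, `l = 283`** (`p = 5`, `m = v_p(abc) = 11`, `k = 22`, top label `i = 140`); R-W datum
`pilotDataOfK:frey-283-8251953125-8251953408:283` (Szpiro-bad, margin -24.805700; every packet WINDOW (S_H not refuted by R-W)). Model-free kernel NEG of the I06⋆ data clause for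
EVERY Θ-volume datum there (existence not claimed). [claim: Mochizuki2012, status: disputed] -/
theorem not_i06StarCellsAt_F05_l283
    (T : Cor22.ThetaVolumeDatumAt (ratPoint ((283 : ℕ) / (8251953408 : ℕ) : ℚ)) 283) : ¬ I06StarCellsAt T :=
  not_i06StarCellsAt_frey T (b := 8251953125) (by norm_num) (by norm_num) (by norm_num) ⟨5, by norm_num⟩ (by norm_num) (by norm_num)
    (m := 11) (r := 394666175644416) (by norm_num) (by norm_num) (by norm_num) (by norm_num)
    (k := 22) (i := 140) (by norm_num) (by norm_num) (by norm_num) (by norm_num)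

/-- **F08: `73 + 5973865915867136 = 5973865915867209`, `l = 73`** (`p = 3`, `m = v_p(abc) = 16`, `k = 27`, top label `i = 35`); R-W datum
`pilotDataOfK:frey-73-5973865915867136-5973865915867209:73` (Szpiro-bad, margin -5.141685; every packet WINDOW (S_H not refuted by R-W)). Model-free kernel NEG of the I06⋆ data clause for
EVERY Θ-volume datum there (existence not claimed). [claim: Mochizuki2012, status: disputed] -/
theorem not_i06StarCellsAt_F08_l73
    (T : Cor22.ThetaVolumeDatumAt (ratPoint ((73 : ℕ) / (5973865915867209 : ℕ) : ℚ)) 73) : ¬ I06StarCellsAt T :=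
  not_i06StarCellsAt_frey T (b := 5973865915867136) (by norm_num) (by norm_num) (by norm_num) ⟨3, by norm_num⟩ (by norm_num) (by norm_num)
    (m := 16) (r := 60519276267185270965133312) (by norm_num) (by norm_num) (by norm_num) (by norm_num)
    (k := 27) (i := 35) (by norm_num) (by norm_num) (by norm_num) (by norm_num)

/-- **F08: `73 + 5973865915867136 = 5973865915867209`, `l = 127`** (`p = 3`, `m = v_p(abc) = 16`, `k = 29`, top label `i = 62`); R-W datum
`pilotDataOfK:frey-73-5973865915867136-5973865915867209:127` (Szpiro-bad, margin -6.993457; every packet WINDOW (S_H not refuted by R-W)). Model-free kernel NEG of the I06⋆ data clause for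
EVERY Θ-volume datum there (existence not claimed). [claim: Mochizuki2012, status: disputed] -/
theorem not_i06StarCellsAt_F08_l127
    (T : Cor22.ThetaVolumeDatumAt (ratPoint ((73 : ℕ) / (5973865915867209 : ℕ) : ℚ)) 127) : ¬ I06StarCellsAt T :=
  not_i06StarCellsAt_frey T (b := 5973865915867136) (by norm_num) (by norm_num) (by norm_num) ⟨3, by norm_num⟩ (by norm_num) (by norm_num)
    (m := 16) (r := 60519276267185270965133312) (by norm_num) (by norm_num) (by norm_num) (by norm_num)
    (k := 29) (i := 62) (by norm_num) (by norm_num) (by norm_num) (by norm_num)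

/-! ## §5 (v2 append). Against `H⋆₂` directly: at a Frey datum class where the I06⋆ data clause fails for EVERY datum, `HStarSzpiroBadCut`
forces every admissible Szpiro-bad datum to be DEEP — so `H⋆₂` is refuted by the first WINDOW datum that exists there -/

/-- **`H⋆₂` ⟹ «no window datum» at any point/level where the I06⋆ data clause fails for every datum** (e.g. each of the 133 Szpiro-bad Frey data
of this file and its sequels, via `not_i06StarCellsAt_F<nn>_l<l>`): under `HStarSzpiroBadCut`, admissibility of `(P, l)` (`P ∈ UP`, `l` prime `≥ 5`,
`AdmitsCore`, `CondP2/P5/P6` — HYPOTHESES) and the Szpiro-bad disjunction of p450130 (HYPOTHESIS), every `T : Cor22.ThetaVolumeDatumAt P l` lies ON the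
depth locus. Existence of such `T` is NOT claimed; with one window datum `RHSzpiroBadCut.not_hStar_of_witness` refutes `H⋆₂`.
[claim: Mochizuki2012, status: disputed] -/
theorem deep_of_hStar_of_forall_not_cells {P : NFPoint} {l : ℕ} (hall : ∀ T : Cor22.ThetaVolumeDatumAt P l, ¬ I06StarCellsAt T)
    (hH : HStarSzpiroBadCut) (hP : P ∈ UP) (hl : l.Prime) (h5 : 5 ≤ l)
    (hc : Cor22.AdmitsCore P) (h2 : Cor22.CondP2 P l) (h5' : Cor22.CondP5 P l) (h6 : Cor22.CondP6 P l)
    (hbad : ((l : ℝ) + 5) / 4 < (Cor22.dmod P : ℝ) ∨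
      6 * l * (((l : ℝ) + 5) - 4 * Cor22.dmod P) / (((l : ℝ) + 4) * ((l : ℝ) - 3))
          * (P.logDiff + (1 - 1 / (l : ℝ)) * Cor22.logCondAvoid P {2, l})
        + 6 * l * ((l : ℝ) + 5) / (((l : ℝ) + 4) * ((l : ℝ) - 3)) * Real.log Real.pi < Cor22.logQAvoid P {2, l})
    (T : Cor22.ThetaVolumeDatumAt P l) :
    letI := T.instFieldF; letI := T.instNumberFieldF; letI := T.instAlgebraF; letI := T.instFieldK
    letI := T.instNumberFieldK; letI := T.instAlgebraK; letI := T.instFieldFbar; letI := T.instAlgebraFbar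
    letI := T.instAlgebraKFbar; letI := T.instIsElliptic
    ∃ (pp : Nat.Primes) (_ : 2 < (pp : ℕ)) (i : Fin (thetaIndex (pilotDataOfK T.D T.K)).lstar)
        (x₀ : (thetaIndex (pilotDataOfK T.D T.K)).Fibre (.inr pp)),
      haveI : Fact (pp : ℕ).Prime := ⟨pp.2⟩
      ((pp : ℕ) : ℝ) ^ ((((i : ℕ) : ℝ) + 2) * (4 + 2 * Real.logb (pp : ℕ) (Module.finrank ℚ T.K)) + 1) *
        ‖(exists_realising_qIdeles_pilotDataOfK T.D).choose pp x₀‖ ^ (((i : ℕ) + 1) ^ 2 - 1) < 1 := by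
  by_contra hwin
  exact hall T (hH P hP l hl h5 hc h2 h5' h6 hbad T hwin)

/-- **The `283 + 5¹¹·13² = 2⁸·3⁸·17³`, `l = 13` instance against `H⋆₂`** (a WINDOW datum class of R-W's table: Szpiro-bad margin −24.8…, every packet
un-refuted — so IF one admissible Θ-volume datum exists there and the Szpiro-bad/admissibility hypotheses are granted, `H⋆₂` says it is deep, while
R-W's `deg_locus = off` says it is not: the row-2 KILL located at one named genuine class). [claim: Mochizuki2012, status: disputed] -/
theorem deep_of_hStar_F05_l13 (hH : HStarSzpiroBadCut)
    (hP : ratPoint ((283 : ℕ) / (8251953408 : ℕ) : ℚ) ∈ UP) (hc : Cor22.AdmitsCore (ratPoint ((283 : ℕ) / (8251953408 : ℕ) : ℚ)))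
    (h2 : Cor22.CondP2 (ratPoint ((283 : ℕ) / (8251953408 : ℕ) : ℚ)) 13) (h5' : Cor22.CondP5 (ratPoint ((283 : ℕ) / (8251953408 : ℕ) : ℚ)) 13)
    (h6 : Cor22.CondP6 (ratPoint ((283 : ℕ) / (8251953408 : ℕ) : ℚ)) 13)
    (hbad : (((13 : ℕ) : ℝ) + 5) / 4 < (Cor22.dmod (ratPoint ((283 : ℕ) / (8251953408 : ℕ) : ℚ)) : ℝ) ∨
      6 * (13 : ℕ) * ((((13 : ℕ) : ℝ) + 5) - 4 * Cor22.dmod (ratPoint ((283 : ℕ) / (8251953408 : ℕ) : ℚ))) / ((((13 : ℕ) : ℝ) + 4) * (((13 : ℕ) : ℝ) - 3))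
          * ((ratPoint ((283 : ℕ) / (8251953408 : ℕ) : ℚ)).logDiff
            + (1 - 1 / ((13 : ℕ) : ℝ)) * Cor22.logCondAvoid (ratPoint ((283 : ℕ) / (8251953408 : ℕ) : ℚ)) {2, 13})
        + 6 * (13 : ℕ) * (((13 : ℕ) : ℝ) + 5) / ((((13 : ℕ) : ℝ) + 4) * (((13 : ℕ) : ℝ) - 3)) * Real.log Real.pi <
          Cor22.logQAvoid (ratPoint ((283 : ℕ) / (8251953408 : ℕ) : ℚ)) {2, 13})
    (T : Cor22.ThetaVolumeDatumAt (ratPoint ((283 : ℕ) / (8251953408 : ℕ) : ℚ)) 13) :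
    letI := T.instFieldF; letI := T.instNumberFieldF; letI := T.instAlgebraF; letI := T.instFieldK
    letI := T.instNumberFieldK; letI := T.instAlgebraK; letI := T.instFieldFbar; letI := T.instAlgebraFbar
    letI := T.instAlgebraKFbar; letI := T.instIsElliptic
    ∃ (pp : Nat.Primes) (_ : 2 < (pp : ℕ)) (i : Fin (thetaIndex (pilotDataOfK T.D T.K)).lstar)
        (x₀ : (thetaIndex (pilotDataOfK T.D T.K)).Fibre (.inr pp)),
      haveI : Fact (pp : ℕ).Prime := ⟨pp.2⟩
      ((pp : ℕ) : ℝ) ^ ((((i : ℕ) : ℝ) + 2) * (4 + 2 * Real.logb (pp : ℕ) (Module.finrank ℚ T.K)) + 1) *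
        ‖(exists_realising_qIdeles_pilotDataOfK T.D).choose pp x₀‖ ^ (((i : ℕ) + 1) ^ 2 - 1) < 1 :=
  deep_of_hStar_of_forall_not_cells not_i06StarCellsAt_F05_l13 hH hP (by norm_num) (by norm_num) hc h2 h5' h6 hbad T

end Summit.ABC.IUTFork.Repair.RHSzpiroBadCutFreyFamily

end
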